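import Literature.MathematicalPhysics.QuantumLattice.SectorGroundState
import Literature.MathematicalPhysics.QuantumLattice.HubbardBootstrapCertificate
import Literature.MathematicalPhysics.QuantumLattice.ContractionResidualBound
import Literature.MathematicalPhysics.QuantumLattice.LadderWordCharge
import Literature.MathematicalPhysics.QuantumLattice.RegionalNumberCharge
import Literature.MathematicalPhysics.QuantumLattice.FermionOperatorsSpinHermitianProofs
import Literature.MathematicalPhysics.QuantumLattice.InterClusterKernelSelectionRules
import HarnessLib

/-!
# Hubbard bootstrap certificates with both conserved charges: `N̂` and `S^z`

Family `hubbard` (topic `MathematicalPhysics/QuantumLattice`). The number- and spin-conserving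
many-body bootstrap (Han 2020 §2: "`⟨O⟩ = 0` unless `O` commutes with the conserved charges") and
its rounded certificates (bundle papers/HubbardSuperconductivity/manybody-bootstrap/, format
`certsdp/1` §3, mode `sector`, flag `zero_charge_moments`) DROP from the residual every
normal-ordered monomial `α` whose charge pair `q(α) = (#c† − #c, Σ spin(c†) − Σ spin(c))` is
non-zero. The particle component is justified on every vector of the `N`-particle sector
(`star_dotProduct_ladderWord_mulVec_eq_zero`); the spin component only on `S^z`-eigenvectors —
and the sector ground state can be CHOSEN to be one
(`Matrix.exists_unit_joint_eigenvector_minEnergyOn`). This file supplies the Hubbard instances: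

* `spinZ_comm_creation` / `spinZ_comm_annihilation`: `[S^z, c†_{xσ}] = ±½ c†_{xσ}`,
  `[S^z, c_{xσ}] = ∓½ c_{xσ}` (from the regional-number charge calculus,
  `numberDiag_comm_creation`);
* `ladderSpinCharge` (the integer `2S^z`-charge of a word) and `spinZ_comm_ladderWord`:
  `[S^z, w] = (ladderSpinCharge w / 2) · w`;
* `exists_unit_joint_groundState`: a unit `N`-particle ground vector of `hamiltonian G t U` that is
  an `S^z`-eigenvector;
* `groundEnergyAt_ge_of_certificate_charged`: an identity
  `H − c·1 = Σ Λᵢⱼ Oᵢᴴ Oⱼ + ((Σ [H, Xₖ] + Σ (Yₗ (N̂ − N) + (N̂ − N) Y'ₗ)) + Σⱼ bⱼ wⱼ) + Σₖ aₖ vₖ`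
  with `Λ ⪰ 0`, CHARGED words `wⱼ` (`ladderCharge wⱼ ≠ 0 ∨ ladderSpinCharge wⱼ ≠ 0`) and residual
  words `vₖ` proves `c − Σₖ ‖aₖ‖ ≤ groundEnergyAt G t U N` — no Hermiticity hypothesis on the
  residual (state form of the bound, `le_re_map_of_certificate_residual`).

Everything is PROVED; the only definition is the bookkeeping function `ladderSpinCharge`.

## References
* X. Han, *Quantum many-body bootstrap*, arXiv:2006.06002 (2020), §2. [cite: Han2020Bootstrap, §2]
* I. Kull, N. Schuch, B. Dive, M. Navascués, *Lower bounds on ground-state energies of local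
  Hamiltonians through the renormalization group*, PRX 14 (2024) 021008, §5.3.
  [cite: KullEtAl2024, §5.3]
* E. H. Lieb, *Two theorems on the Hubbard model*, PRL 62 (1989) 1201 (`H` conserves `N`, `S^z`).
  [cite: LiebPRL1989]
-/

noncomputable section

open Matrix Finset
open scoped ComplexOrder BigOperators
open Literature.MathematicalPhysics.QuantumManyBody.StateRelaxation

namespace Literature.MathematicalPhysics.QuantumLattice

variable {Λ : Type*} [LinearOrder Λ] [Fintype Λ]

/-! ### `S^z` charges of the ladder matrices -/

omit [Fintype Λ] in
/-- `orb y τ` lies in the spin-`σ` orbital set iff `τ = σ`. [folklore] -/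
theorem orb_mem_image_orb_iff (S : Finset Λ) (hy : ∀ y, y ∈ S) (y : Λ) (τ σ : Fin 2) :
    orb y τ ∈ S.image (fun x => orb x σ) ↔ τ = σ := by
  simp only [Finset.mem_image]
  constructor
  · rintro ⟨x, -, hx⟩
    exact ((Prod.mk.inj (toLex_inj.mp hx)).2).symm
  · rintro rfl
    exact ⟨y, hy y, rfl⟩

/-- `S^z = ½ (N_↑ − N_↓)` with `N_σ = diag(#(s ∩ orbitals of spin σ))` the regional number of the
spin-`σ` orbitals. Lieb, PRL 62 (1989) 1201, eq. (2). [cite: LiebPRL1989, eq. (2)] -/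
theorem spinZ_eq_half_smul_numberDiag_sub :
    (HubbardWave0.spinZ : Matrix (Finset (Orb Λ)) (Finset (Orb Λ)) ℂ) =
      (1 / 2 : ℂ) • (diagonal (fun s : Finset (Orb Λ) =>
          (((s ∩ (univ : Finset Λ).image (fun x => orb x 0)).card : ℕ) : ℂ)) -
        diagonal (fun s : Finset (Orb Λ) =>
          (((s ∩ (univ : Finset Λ).image (fun x => orb x 1)).card : ℕ) : ℂ))) := by
  have h : ∀ σ : Fin 2, ∑ x : Λ, QuantumLattice.numberOp x σ =
      diagonal (fun s : Finset (Orb Λ) =>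
        (((s ∩ (univ : Finset Λ).image (fun x => orb x σ)).card : ℕ) : ℂ)) := by
    intro σ
    rw [← sum_numberAt_eq_numberDiag,
      Finset.sum_image (fun x _ y _ h => (Prod.mk.inj (toLex_inj.mp h)).1)]
    rfl
  rw [HubbardWave0.spinZ, Finset.sum_sub_distrib, h 0, h 1]

/-- **`S^z` charge of a creation operator**: `S^z c†_{yτ} − c†_{yτ} S^z = ±½ c†_{yτ}`
(`+` for `τ = ↑ = 0`, `−` for `τ = ↓ = 1`). Han 2020 §2 (spin as a conserved charge `C`).
[cite: Han2020Bootstrap, §2] -/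
theorem spinZ_comm_creation (y : Λ) (τ : Fin 2) :
    HubbardWave0.spinZ * creation (orb y τ) - creation (orb y τ) * HubbardWave0.spinZ =
      ((1 / 2 : ℂ) * (if τ = 0 then 1 else -1)) • creation (orb y τ) := by
  classical
  rw [spinZ_eq_half_smul_numberDiag_sub, Matrix.smul_mul, Matrix.mul_smul, ← smul_sub,
    Matrix.sub_mul, Matrix.mul_sub,
    show ∀ a b c d : Matrix (Finset (Orb Λ)) (Finset (Orb Λ)) ℂ, a - b - (c - d) = (a - c) - (b - d)
      from fun a b c d => by abel,
    numberDiag_comm_creation, numberDiag_comm_creation, ← sub_smul, smul_smul]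
  congr 1
  simp only [orb_mem_image_orb_iff univ Finset.mem_univ]
  fin_cases τ <;> simp

/-- **`S^z` charge of an annihilation operator**: `S^z c_{yτ} − c_{yτ} S^z = ∓½ c_{yτ}` (adjoint of
`spinZ_comm_creation`). [cite: Han2020Bootstrap, §2] -/
theorem spinZ_comm_annihilation (y : Λ) (τ : Fin 2) :
    HubbardWave0.spinZ * annihilation (orb y τ) - annihilation (orb y τ) * HubbardWave0.spinZ =
      (-((1 / 2 : ℂ) * (if τ = 0 then 1 else -1))) • annihilation (orb y τ) := by
  have h := comm_conjTranspose_of_comm_eq_smul HubbardWave0.spinZ_isHermitian.eq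
    (spinZ_comm_creation y τ)
  rw [creation_conjTranspose] at h
  rw [h]
  congr 1
  split_ifs <;> simp

omit [LinearOrder Λ] [Fintype Λ] in
/-- The `2S^z`-charge of a ladder letter `(i, dag)`: `spin(i) = +1 (↑), −1 (↓)` for a creator,
the negative for an annihilator. [folklore] -/
def letterSpinCharge (p : Orb Λ × Bool) : ℤ :=
  (if p.2 then (1 : ℤ) else -1) * (if (ofLex p.1).2 = 0 then 1 else -1)

omit [LinearOrder Λ] [Fintype Λ] in
/-- The `2S^z`-charge of a ladder word: `Σ spin(creators) − Σ spin(annihilators)` (the second charge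
component of `certsdp/1` §3). [folklore] -/
def ladderSpinCharge (l : List (Orb Λ × Bool)) : ℤ := (l.map letterSpinCharge).sum

omit [LinearOrder Λ] [Fintype Λ] in
/-- `ladderSpinCharge nil`. [folklore] -/
@[simp] theorem ladderSpinCharge_nil : ladderSpinCharge ([] : List (Orb Λ × Bool)) = 0 := by
  simp [ladderSpinCharge]

omit [LinearOrder Λ] [Fintype Λ] in
/-- `ladderSpinCharge cons`. [folklore] -/
@[simp] theorem ladderSpinCharge_cons (p : Orb Λ × Bool) (l : List (Orb Λ × Bool)) :
    ladderSpinCharge (p :: l) = letterSpinCharge p + ladderSpinCharge l := by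
  simp [ladderSpinCharge]

/-- `spinZ_comm_creation` for an orbital `i : Orb Λ` (`i = orb (ofLex i).1 (ofLex i).2`).
[cite: Han2020Bootstrap, §2] -/
theorem spinZ_comm_creation' (i : Orb Λ) :
    HubbardWave0.spinZ * creation i - creation i * HubbardWave0.spinZ =
      ((1 / 2 : ℂ) * (if (ofLex i).2 = 0 then 1 else -1)) • creation i :=
  spinZ_comm_creation (ofLex i).1 (ofLex i).2

/-- `spinZ_comm_annihilation` for an orbital `i : Orb Λ`. [cite: Han2020Bootstrap, §2] -/
theorem spinZ_comm_annihilation' (i : Orb Λ) :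
    HubbardWave0.spinZ * annihilation i - annihilation i * HubbardWave0.spinZ =
      (-((1 / 2 : ℂ) * (if (ofLex i).2 = 0 then 1 else -1))) • annihilation i :=
  spinZ_comm_annihilation (ofLex i).1 (ofLex i).2

/-- `S^z` charge of a ladder letter: `[S^z, a] = (letterSpinCharge a / 2) · a`. [folklore] -/
theorem spinZ_comm_ladderLetter (p : Orb Λ × Bool) :
    HubbardWave0.spinZ * ladderLetter p - ladderLetter p * HubbardWave0.spinZ =
      (((letterSpinCharge p : ℤ) : ℂ) / 2) • ladderLetter p := by
  obtain ⟨i, b⟩ := p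
  cases b
  · simp only [ladderLetter, letterSpinCharge, Bool.false_eq_true, if_false]
    rw [spinZ_comm_annihilation' i]
    congr 1
    split_ifs <;> push_cast <;> ring
  · simp only [ladderLetter, letterSpinCharge, if_true]
    rw [spinZ_comm_creation' i]
    congr 1
    split_ifs <;> push_cast <;> ring

/-- **`S^z` charge of a ladder word**: `[S^z, w] = (ladderSpinCharge w / 2) · w` (charges add along
the word, `comm_mul_of_comm_eq_smul`). Han 2020 §2. [cite: Han2020Bootstrap, §2] -/
theorem spinZ_comm_ladderWord (l : List (Orb Λ × Bool)) :
    HubbardWave0.spinZ * ladderWord l - ladderWord l * HubbardWave0.spinZ =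
      (((ladderSpinCharge l : ℤ) : ℂ) / 2) • ladderWord l := by
  induction l with
  | nil => simp
  | cons p l ih =>
    rw [ladderWord_cons, comm_mul_of_comm_eq_smul (spinZ_comm_ladderLetter p) ih, ladderSpinCharge_cons]
    congr 1
    push_cast
    ring

/-- **Spin-charged words have zero expectation in an `S^z`-eigenvector**: `S^z ψ = q ψ`,
`ladderSpinCharge w ≠ 0` ⇒ `⟨ψ, w ψ⟩ = 0`. Han 2020 §2. [cite: Han2020Bootstrap, §2] -/
theorem star_dotProduct_ladderWord_mulVec_eq_zero_of_spinCharge {q : ℝ} {ψ : Fock (Orb Λ)}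
    (hψ : HubbardWave0.spinZ *ᵥ ψ = (q : ℂ) • ψ) (l : List (Orb Λ × Bool))
    (hl : ladderSpinCharge l ≠ 0) : star ψ ⬝ᵥ ladderWord l *ᵥ ψ = 0 :=
  Matrix.star_dotProduct_mulVec_eq_zero_of_charge HubbardWave0.spinZ_isHermitian hψ
    (div_ne_zero (Int.cast_ne_zero.mpr hl) two_ne_zero) (spinZ_comm_ladderWord l)

/-! ### Joint `(N, S^z)` ground vectors and the charged certificate -/

section Certificate

variable (G : SimpleGraph Λ) [DecidableRel G.Adj]

/-- **A unit sector ground state with definite `S^z`.** For `N ≤ 2|Λ|` there is a unit vector `ψ`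
of the `N`-particle sector with `H ψ = E_N ψ`, `E_N = groundEnergyAt G t U N`, and `S^z ψ = q ψ`
(`H` conserves `N̂` and `S^z`, which preserve the sector; `Matrix.exists_unit_joint_eigenvector_minEnergyOn`).
Lieb, PRL 62 (1989) 1201 ("work in a fixed `S^z` subspace"). [cite: LiebPRL1989] -/
theorem exists_unit_joint_groundState (t U : ℝ) {N : ℕ} (hN : N ≤ 2 * Fintype.card Λ) :
    ∃ ψ : Fock (Orb Λ), IsNParticle N ψ ∧ star ψ ⬝ᵥ ψ = 1 ∧
      hamiltonian G t U *ᵥ ψ = ((groundEnergyAt G t U N : ℝ) : ℂ) • ψ ∧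
      ∃ q : ℝ, HubbardWave0.spinZ *ᵥ ψ = (q : ℂ) • ψ := by
  set H := hamiltonian G t U with hH
  set K : Submodule ℂ (Fock (Orb Λ)) := nParticleSubmodule N with hK
  have hKA : ∀ v ∈ K, H *ᵥ v ∈ K := fun v hv =>
    IsNParticle.mulVec_of_commute_totalNumberOp (hamiltonian_commute_totalNumberOp G t U) hv
  have hKne : K ≠ ⊥ := by
    obtain ⟨φ, hφN, hφ1, -⟩ := ThermodynamicLimit.exists_unit_groundState G t U hN
    rw [Submodule.ne_bot_iff]
    refine ⟨φ, hφN, ?_⟩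
    rintro rfl
    simp at hφ1
  have hQK : ∀ v ∈ K, HubbardWave0.spinZ *ᵥ v ∈ K := fun v hv s hs => by
    show (HubbardWave0.spinZ *ᵥ v) s = 0
    rw [LiebThm1.spinZ_mulVec_apply, (show IsNParticle N v from hv) s hs, mul_zero]
  have hQA : HubbardWave0.spinZ * H = H * HubbardWave0.spinZ :=
    (hamiltonian_isHermitian_and_commute_holds G t U).2.2.eq.symm
  obtain ⟨v, hvK, hv1, hAv, q, hQv⟩ := Matrix.exists_unit_joint_eigenvector_minEnergyOn
    (LiebThm1.hamiltonian_isHermitian G t U) K hKA hKne HubbardWave0.spinZ_isHermitian hQA hQK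
  refine ⟨v, hvK, hv1, ?_, q, hQv⟩
  rw [hAv, groundEnergyAt, groundEnergy_eq_minEnergyOn H N K fun ψ => Iff.rfl]

/-- **Charged bootstrap certificate ⇒ sector ground-energy lower bound (Hubbard).** An identity
`H − c·1 = Σᵢⱼ Λᵢⱼ Oᵢᴴ Oⱼ + ((Σₖ (H Xₖ − Xₖ H) + Σₗ (Yₗ (N̂ − N) + (N̂ − N) Y'ₗ)) + Σⱼ bⱼ wⱼ) + Σₖ aₖ vₖ`
with `Λ ⪰ 0`, CHARGED ladder words `wⱼ` (`ladderCharge wⱼ ≠ 0 ∨ ladderSpinCharge wⱼ ≠ 0`) and residual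
ladder words `vₖ` proves `c − Σₖ ‖aₖ‖ ≤ groundEnergyAt G t U N` (`N ≤ 2|Λ|`): evaluate in the vector
state of a joint `(N, S^z)` ground vector, where commutators, sector-ideal terms and charged words
vanish and each residual word, a contraction, contributes at least `−‖aₖ‖`. This is the soundness
statement of a `certsdp/1` sector-mode certificate with `zero_charge_moments`. Han 2020 §2 eq. (2)–(3);
KSDN 2024 §5.3. [cite: Han2020Bootstrap, §2 eq. (2)–(3)] -/
theorem groundEnergyAt_ge_of_certificate_charged (t U : ℝ) {N : ℕ} (hN : N ≤ 2 * Fintype.card Λ)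
    {m : Type*} [Fintype m] [DecidableEq m] {Λm : Matrix m m ℂ} (hΛ : Λm.PosSemidef)
    (O : m → Matrix (Finset (Orb Λ)) (Finset (Orb Λ)) ℂ)
    {κ : Type*} (s : Finset κ) (X : κ → Matrix (Finset (Orb Λ)) (Finset (Orb Λ)) ℂ)
    {κ' : Type*} (s' : Finset κ') (Y Y' : κ' → Matrix (Finset (Orb Λ)) (Finset (Orb Λ)) ℂ)
    {ρ : Type*} (u : Finset ρ) (b : ρ → ℂ) (cw : ρ → List (Orb Λ × Bool))
    (hcw : ∀ j ∈ u, ladderCharge (cw j) ≠ 0 ∨ ladderSpinCharge (cw j) ≠ 0)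
    {κ'' : Type*} (w : Finset κ'') (a : κ'' → ℂ) (word : κ'' → List (Orb Λ × Bool)) {c : ℝ}
    (hcert : hamiltonian G t U - (c : ℂ) • (1 : Matrix (Finset (Orb Λ)) (Finset (Orb Λ)) ℂ) =
      gramForm Λm O +
        ((∑ k ∈ s, (hamiltonian G t U * X k - X k * hamiltonian G t U) +
          ∑ l ∈ s', (Y l * (totalNumberOp - (N : ℂ) • 1) + (totalNumberOp - (N : ℂ) • 1) * Y' l)) +
          ∑ j ∈ u, b j • ladderWord (cw j)) +
        ∑ k ∈ w, a k • ladderWord (word k)) :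
    c - ∑ k ∈ w, ‖a k‖ ≤ groundEnergyAt G t U N := by
  obtain ⟨ψ, hψN, hψ1, hHψ, q, hSψ⟩ := exists_unit_joint_groundState G t U hN
  set ω := vectorState ψ with hω
  have hpos : ∀ x : Matrix (Finset (Orb Λ)) (Finset (Orb Λ)) ℂ, 0 ≤ ω (star x * x) :=
    fun x => vectorState_nonneg ψ x
  have hone : ω 1 = 1 := by rw [hω, vectorState_apply, one_mulVec, hψ1]
  have hHh := LiebThm1.hamiltonian_isHermitian G t U
  have hnull : ω ((∑ k ∈ s, (hamiltonian G t U * X k - X k * hamiltonian G t U) +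
      ∑ l ∈ s', (Y l * (totalNumberOp - (N : ℂ) • 1) + (totalNumberOp - (N : ℂ) • 1) * Y' l)) +
      ∑ j ∈ u, b j • ladderWord (cw j)) = 0 := by
    rw [map_add, map_add, map_sum, map_sum, map_sum]
    have h1 : ∀ k ∈ s, ω (hamiltonian G t U * X k - X k * hamiltonian G t U) = 0 :=
      fun k _ => vectorState_commutator hHh hHψ _
    have h2 : ∀ l ∈ s',
        ω (Y l * (totalNumberOp - (N : ℂ) • 1) + (totalNumberOp - (N : ℂ) • 1) * Y' l) = 0 :=
      fun l _ => by
        have hZ : (totalNumberOp - (N : ℂ) • (1 : Matrix (Finset (Orb Λ)) (Finset (Orb Λ)) ℂ)) *ᵥ ψ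
            = 0 := totalNumberOp_sub_mulVec_of_isNParticle N hψN
        have hZ' : (totalNumberOp - (N : ℂ) • (1 : Matrix (Finset (Orb Λ)) (Finset (Orb Λ)) ℂ))ᴴ *ᵥ ψ
            = 0 := by rw [conjTranspose_totalNumberOp_sub]; exact hZ
        have e1 : vectorState ψ (Y l * (totalNumberOp - (N : ℂ) •
            (1 : Matrix (Finset (Orb Λ)) (Finset (Orb Λ)) ℂ))) = 0 :=
          vectorState_mul_of_mulVec_eq_zero ψ (Y l) hZ
        have e2 : vectorState ψ ((totalNumberOp - (N : ℂ) •
            (1 : Matrix (Finset (Orb Λ)) (Finset (Orb Λ)) ℂ)) * Y' l) = 0 :=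
          vectorState_mul_of_conjTranspose_mulVec_eq_zero ψ (Y' l) hZ'
        rw [map_add, hω, e1, e2, add_zero]
    have h3 : ∀ j ∈ u, ω (b j • ladderWord (cw j)) = 0 := fun j hj => by
      rw [map_smul, hω, vectorState_apply, smul_eq_mul]
      rcases hcw j hj with hq | hq
      · rw [star_dotProduct_ladderWord_mulVec_eq_zero hψN (cw j) hq, mul_zero]
      · rw [star_dotProduct_ladderWord_mulVec_eq_zero_of_spinCharge hSψ (cw j) hq, mul_zero]
    rw [Finset.sum_eq_zero h1, Finset.sum_eq_zero h2, Finset.sum_eq_zero h3, add_zero, add_zero]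
  have hr : -(∑ k ∈ w, ‖a k‖) ≤ (ω (∑ k ∈ w, a k • ladderWord (word k))).re :=
    neg_sum_norm_le_re_map_sum w ω a (fun k => ladderWord (word k)) fun k _ => by
      have h := (isContraction_prod_ladder (word k)).neg_norm_mul_le (a k) ψ
      rw [hψ1, Complex.one_re, mul_one] at h
      rw [hω, vectorState_apply, ladderWord_eq_prod]
      exact h
  have h := le_re_map_of_certificate_residual ω hpos hone hΛ O hnull hr hcert
  rwa [hω, vectorState_apply, hHψ, dotProduct_smul, hψ1, smul_eq_mul, mul_one,
    Complex.ofReal_re] at h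

end Certificate

end Literature.MathematicalPhysics.QuantumLattice
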